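import Summits.ABC.ABC.Theses.CubicResolventAllowance
import Summits.ABC.ABC.Theorems.PlaceCountSzpiroPlaceBudgetPayoff
import Literature.NumberTheory.EllipticCurves.HeightConductorBoundsModularity
import Literature.NumberTheory.EllipticCurves.PastenValuationProductMestreOesterleProofs
import Literature.NumberTheory.DiophantineGeometry.MinimalDiscriminantProofs

/-!
# Stub ideation k=2, generation 3 (RESHAPE) — `stub_complexCubic` of crux `IndexSzpiro` (stmt-ABC-22740)

Elaboration sanity (and, where cheap, kernel-checked glue) for the NEW gen-3 helpers proposed in
`STUB-IDEAS-stub_complexCubic-2.md`: technique E (weaken-and-bootstrap: a free factor `A` per bad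
prime, bootstrapped away by `ω(N)! ≤ N`), technique F (quantifier reshape: the `C`-free EVENTUAL form,
glued back to the stub by von Känel's printed ceiling), their combination (the LOCAL-BUDGET NORMAL
FORM in log currency), and technique G (quantifier elimination of `K`: rigidity of the resolvent field).
Gen-1/2 helpers live in `STUB_IDEAS_stub_complexCubic_2_Sketch.lean` / `StubIdeas2G2Sketch.lean`.
Scratch namespace, nothing here is a tree proposal — but EVERYTHING below is kernel-checked (`lean check`
rc 0, 0 `sorry`): the reshapings E/F/N are proved EQUIVALENT to the stub (F2/N2 modulo the named fact
`vonKanel2014_log_minimalDiscriminant_le`, vK 2014 Cor. 6.2, used only as Shafarevich-finiteness for the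
conductors below `N₀`), and G1/G2 are proved outright.  The only open statement is the stub itself.
Caveat for typers: `log |d_K|` does NOT localise on `N.primeFactors` — `2 ∣ d_K` is possible at good
reduction at 2 (11a1: `N = 11`, `d_K = −44`); primes of `d_K` ⊆ `N.primeFactors ∪ {2}`, `v₂(d_K) ≤ 3`.
-/

open Polynomial

namespace Summit.ABC.ABC.Cruxes.IndexSzpiro.StubIdeas2G3

open Literature.NumberTheory.EllipticCurves.ModularForms
open Summit.ABC.ABC.Theorems.PlaceCountSzpiroPayoff

/-- The target stub, verbatim (= `Sig`-free registered signature of `stub_complexCubic`). -/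
def StubComplexCubic : Prop :=
  ∀ ε : ℝ, 0 < ε → ∃ C : ℝ, ∀ (W : WeierstrassCurve ℚ) [W.IsElliptic] (K : Type) [Field K]
    [NumberField K], Irreducible W.twoTorsionPolynomial.toPoly → Module.finrank ℚ K = 3 →
    (∃ θ : K, aeval θ W.twoTorsionPolynomial.toPoly = 0) → NumberField.discr K < 0 →
    (W.minimalDiscriminantNorm ℤ : ℝ) ≤
      C * |(NumberField.discr K : ℝ)| * (W.conductorNorm ℤ : ℝ) ^ (6 + ε)

/-! ## Technique E — WEAKEN-AND-BOOTSTRAP: one free factor `A ≥ 1` per bad prime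

`ω(N) = #N.primeFactors`.  The weakening allows the constant to grow like `A ^ (ω(N_E) + 1)`; the
bootstrap is the tree lemma `PlaceCountSzpiroPayoff.pow_card_primeFactors_le`
(`A ^ ω(n) ≤ exp(δ A^{1/δ}) · n ^ δ`, from `ω(n)! ≤ n`), so NOTHING is lost: `PlaceBudgetIndexNeg ↔ stub`. -/

/-- **E0 (the place-budgeted stub).** Szpiro `6+ε` with the resolvent allowance AND a free factor `A`
per bad prime. -/
def PlaceBudgetIndexNeg : Prop :=
  ∀ ε : ℝ, 0 < ε → ∃ A : ℝ, 1 ≤ A ∧ ∀ (W : WeierstrassCurve ℚ) [W.IsElliptic] (K : Type) [Field K]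
    [NumberField K], Irreducible W.twoTorsionPolynomial.toPoly → Module.finrank ℚ K = 3 →
    (∃ θ : K, aeval θ W.twoTorsionPolynomial.toPoly = 0) → NumberField.discr K < 0 →
    (W.minimalDiscriminantNorm ℤ : ℝ) ≤
      A ^ ((W.conductorNorm ℤ).primeFactors.card + 1) * |(NumberField.discr K : ℝ)| *
        (W.conductorNorm ℤ : ℝ) ^ (6 + ε)

/-- **E1 (S, VERIFIED).** The stub gives the budgeted form (`A := max C 1`). -/
theorem placeBudget_of_stub (h : StubComplexCubic) : PlaceBudgetIndexNeg := by
  intro ε hε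
  obtain ⟨C, hC⟩ := h ε hε
  refine ⟨max C 1, le_max_right _ _, ?_⟩
  intro W _ K _ _ hirr h3 hθ hd
  have h1 := hC W K hirr h3 hθ hd
  have hA : (1 : ℝ) ≤ max C 1 := le_max_right _ _
  have hpow : max C 1 ≤ max C 1 ^ ((W.conductorNorm ℤ).primeFactors.card + 1) := by
    calc max C 1 = max C 1 ^ 1 := (pow_one _).symm
      _ ≤ max C 1 ^ ((W.conductorNorm ℤ).primeFactors.card + 1) :=
          pow_le_pow_right₀ hA (by omega)
  have hN0 : (0 : ℝ) ≤ (W.conductorNorm ℤ : ℝ) ^ (6 + ε) := Real.rpow_nonneg (Nat.cast_nonneg _) _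
  have habs : (0 : ℝ) ≤ |(NumberField.discr K : ℝ)| := abs_nonneg _
  calc (W.minimalDiscriminantNorm ℤ : ℝ)
      ≤ C * |(NumberField.discr K : ℝ)| * (W.conductorNorm ℤ : ℝ) ^ (6 + ε) := h1
    _ ≤ max C 1 * |(NumberField.discr K : ℝ)| * (W.conductorNorm ℤ : ℝ) ^ (6 + ε) :=
        mul_le_mul_of_nonneg_right (mul_le_mul_of_nonneg_right (le_max_left C 1) habs) hN0
    _ ≤ max C 1 ^ ((W.conductorNorm ℤ).primeFactors.card + 1) * |(NumberField.discr K : ℝ)| *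
          (W.conductorNorm ℤ : ℝ) ^ (6 + ε) :=
        mul_le_mul_of_nonneg_right (mul_le_mul_of_nonneg_right hpow habs) hN0

/-- **E2 (M, VERIFIED — the bootstrap).** The budgeted form gives the stub back:
`A^{ω(N)+1} · N^{6+ε/2} ≤ A·exp((ε/2)·A^{2/ε}) · N^{6+ε}` by `pow_card_primeFactors_le` (`ω(N)! ≤ N`). -/
theorem stub_of_placeBudget (h : PlaceBudgetIndexNeg) : StubComplexCubic := by
  intro ε hε
  have hε2 : 0 < ε / 2 := by linarith
  obtain ⟨A, hA, hW⟩ := h (ε / 2) hε2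
  refine ⟨A * Real.exp ((ε / 2) * A ^ (1 / (ε / 2))), ?_⟩
  intro W _ K _ _ hirr h3 hθ hd
  have h1 := hW W K hirr h3 hθ hd
  have hNpos : 0 < W.conductorNorm ℤ := WeierstrassCurve.conductorNorm_pos_holds W
  have hNne : W.conductorNorm ℤ ≠ 0 := hNpos.ne'
  have hNreal : (0 : ℝ) < (W.conductorNorm ℤ : ℝ) := by exact_mod_cast hNpos
  have hbudget : A ^ (W.conductorNorm ℤ).primeFactors.card ≤
      Real.exp ((ε / 2) * A ^ (1 / (ε / 2))) * ((W.conductorNorm ℤ : ℕ) : ℝ) ^ (ε / 2) :=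
    pow_card_primeFactors_le hA hε2 hNne
  have hA0 : (0 : ℝ) ≤ A := le_trans zero_le_one hA
  have habs : (0 : ℝ) ≤ |(NumberField.discr K : ℝ)| := abs_nonneg _
  have hN0 : (0 : ℝ) ≤ (W.conductorNorm ℤ : ℝ) ^ (6 + ε / 2) := Real.rpow_nonneg (Nat.cast_nonneg _) _
  have hsplit : (W.conductorNorm ℤ : ℝ) ^ (ε / 2) * (W.conductorNorm ℤ : ℝ) ^ (6 + ε / 2) =
      (W.conductorNorm ℤ : ℝ) ^ (6 + ε) := by
    rw [← Real.rpow_add hNreal]; ring_nf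
  calc (W.minimalDiscriminantNorm ℤ : ℝ)
      ≤ A ^ ((W.conductorNorm ℤ).primeFactors.card + 1) * |(NumberField.discr K : ℝ)| *
          (W.conductorNorm ℤ : ℝ) ^ (6 + ε / 2) := h1
    _ = A * A ^ (W.conductorNorm ℤ).primeFactors.card * |(NumberField.discr K : ℝ)| *
          (W.conductorNorm ℤ : ℝ) ^ (6 + ε / 2) := by rw [pow_succ]; ring
    _ ≤ A * (Real.exp ((ε / 2) * A ^ (1 / (ε / 2))) * (W.conductorNorm ℤ : ℝ) ^ (ε / 2)) *
          |(NumberField.discr K : ℝ)| * (W.conductorNorm ℤ : ℝ) ^ (6 + ε / 2) :=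
        mul_le_mul_of_nonneg_right (mul_le_mul_of_nonneg_right
          (mul_le_mul_of_nonneg_left hbudget hA0) habs) hN0
    _ = A * Real.exp ((ε / 2) * A ^ (1 / (ε / 2))) * |(NumberField.discr K : ℝ)| *
          ((W.conductorNorm ℤ : ℝ) ^ (ε / 2) * (W.conductorNorm ℤ : ℝ) ^ (6 + ε / 2)) := by ring
    _ = A * Real.exp ((ε / 2) * A ^ (1 / (ε / 2))) * |(NumberField.discr K : ℝ)| *
          (W.conductorNorm ℤ : ℝ) ^ (6 + ε) := by rw [hsplit]

/-! ## Technique F — QUANTIFIER RESHAPE: the `C`-free EVENTUAL form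

`∀ ε ∃ N₀ : N_E ≥ N₀ → Δ_min ≤ |d_K| · N_E^{6+ε}` (constant ONE).  `stub → eventual` is elementary
(`C ≤ N^{ε/2}` for `N ≥ C^{2/ε}`); `eventual → stub` needs SOME bound `Δ_min ≤ Φ(N_E)` for the finitely
many small conductors — no elementary one exists (that is Shafarevich), so the glue takes the printed
THEOREM von Känel 2014 Cor. 6.2 (`log Δ_min ≤ 3N(log N)² + 124`, named fact
`vonKanel2014_log_minimalDiscriminant_le`) as a hypothesis. -/

/-- **F0 (the eventual stub, `C = 1`).** -/
def EventualIndexSzpiroNeg : Prop :=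
  ∀ ε : ℝ, 0 < ε → ∃ N₀ : ℕ, ∀ (W : WeierstrassCurve ℚ) [W.IsElliptic] (K : Type) [Field K]
    [NumberField K], Irreducible W.twoTorsionPolynomial.toPoly → Module.finrank ℚ K = 3 →
    (∃ θ : K, aeval θ W.twoTorsionPolynomial.toPoly = 0) → NumberField.discr K < 0 →
    N₀ ≤ W.conductorNorm ℤ →
    (W.minimalDiscriminantNorm ℤ : ℝ) ≤ |(NumberField.discr K : ℝ)| * (W.conductorNorm ℤ : ℝ) ^ (6 + ε)

/-- **F1 (S, VERIFIED).** `stub → eventual` with `N₀ = ⌈(max C 1)^{2/ε}⌉₊` for the stub's `C(ε/2)`. -/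
theorem eventual_of_stub (h : StubComplexCubic) : EventualIndexSzpiroNeg := by
  intro ε hε
  have hε2 : 0 < ε / 2 := by linarith
  obtain ⟨C, hC⟩ := h (ε / 2) hε2
  refine ⟨⌈(max C 1) ^ (2 / ε)⌉₊, ?_⟩
  intro W _ K _ _ hirr h3 hθ hd hN
  have h1 := hC W K hirr h3 hθ hd
  have hNpos : 0 < W.conductorNorm ℤ := WeierstrassCurve.conductorNorm_pos_holds W
  have hNreal : (0 : ℝ) < (W.conductorNorm ℤ : ℝ) := by exact_mod_cast hNpos
  have hm0 : (0 : ℝ) ≤ max C 1 := le_trans zero_le_one (le_max_right _ _)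
  have hceil : (max C 1) ^ (2 / ε) ≤ (W.conductorNorm ℤ : ℝ) :=
    (Nat.le_ceil _).trans (by exact_mod_cast hN)
  have hC' : C ≤ (W.conductorNorm ℤ : ℝ) ^ (ε / 2) := by
    have hid : ((max C 1) ^ (2 / ε)) ^ (ε / 2) = max C 1 := by
      rw [← Real.rpow_mul hm0]
      have : (2 / ε) * (ε / 2) = 1 := by field_simp
      rw [this, Real.rpow_one]
    calc C ≤ max C 1 := le_max_left _ _
      _ = ((max C 1) ^ (2 / ε)) ^ (ε / 2) := hid.symm
      _ ≤ (W.conductorNorm ℤ : ℝ) ^ (ε / 2) :=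
          Real.rpow_le_rpow (Real.rpow_nonneg hm0 _) hceil hε2.le
  have habs : (0 : ℝ) ≤ |(NumberField.discr K : ℝ)| := abs_nonneg _
  have hN0 : (0 : ℝ) ≤ (W.conductorNorm ℤ : ℝ) ^ (6 + ε / 2) := Real.rpow_nonneg (Nat.cast_nonneg _) _
  have hsplit : (W.conductorNorm ℤ : ℝ) ^ (ε / 2) * (W.conductorNorm ℤ : ℝ) ^ (6 + ε / 2) =
      (W.conductorNorm ℤ : ℝ) ^ (6 + ε) := by
    rw [← Real.rpow_add hNreal]; ring_nf
  calc (W.minimalDiscriminantNorm ℤ : ℝ)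
      ≤ C * |(NumberField.discr K : ℝ)| * (W.conductorNorm ℤ : ℝ) ^ (6 + ε / 2) := h1
    _ ≤ (W.conductorNorm ℤ : ℝ) ^ (ε / 2) * |(NumberField.discr K : ℝ)| *
          (W.conductorNorm ℤ : ℝ) ^ (6 + ε / 2) :=
        mul_le_mul_of_nonneg_right (mul_le_mul_of_nonneg_right hC' habs) hN0
    _ = |(NumberField.discr K : ℝ)| *
          ((W.conductorNorm ℤ : ℝ) ^ (ε / 2) * (W.conductorNorm ℤ : ℝ) ^ (6 + ε / 2)) := by ring
    _ = |(NumberField.discr K : ℝ)| * (W.conductorNorm ℤ : ℝ) ^ (6 + ε) := by rw [hsplit]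

/-- **F2 (M, VERIFIED).** `eventual → stub`, modulo von Känel 2014 Cor. 6.2 for the conductors `N < N₀`:
`C(ε) := max 1 (exp (3 N₀ (log N₀)² + 124))` works since `|d_K| ≥ 1`, `N^{6+ε} ≥ 1` and
`t ↦ 3t(log t)² + 124` is monotone on `[1, ∞)`. -/
theorem stub_of_eventual (hvK : vonKanel2014_log_minimalDiscriminant_le)
    (h : EventualIndexSzpiroNeg) : StubComplexCubic := by
  intro ε hε
  obtain ⟨N₀, hN₀⟩ := h ε hε
  set B : ℝ := Real.exp (3 * (N₀ : ℝ) * Real.log (N₀ : ℝ) ^ 2 + 124) with hB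
  refine ⟨max 1 B, ?_⟩
  intro W _ K _ _ hirr h3 hθ hd
  have hNpos : 0 < W.conductorNorm ℤ := WeierstrassCurve.conductorNorm_pos_holds W
  have hN1 : (1 : ℝ) ≤ (W.conductorNorm ℤ : ℝ) := by exact_mod_cast hNpos
  have hd1 : (1 : ℝ) ≤ |(NumberField.discr K : ℝ)| := by
    have := Int.one_le_abs (NumberField.discr_ne_zero K)
    exact_mod_cast this
  have hNpow1 : (1 : ℝ) ≤ (W.conductorNorm ℤ : ℝ) ^ (6 + ε) := Real.one_le_rpow hN1 (by linarith)
  have hprod1 : (1 : ℝ) ≤ |(NumberField.discr K : ℝ)| * (W.conductorNorm ℤ : ℝ) ^ (6 + ε) :=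
    one_le_mul_of_one_le_of_one_le hd1 hNpow1
  have hmax0 : (0 : ℝ) ≤ max 1 B := le_trans zero_le_one (le_max_left _ _)
  by_cases hN : N₀ ≤ W.conductorNorm ℤ
  · have h1 := hN₀ W K hirr h3 hθ hd hN
    calc (W.minimalDiscriminantNorm ℤ : ℝ)
        ≤ |(NumberField.discr K : ℝ)| * (W.conductorNorm ℤ : ℝ) ^ (6 + ε) := h1
      _ = 1 * (|(NumberField.discr K : ℝ)| * (W.conductorNorm ℤ : ℝ) ^ (6 + ε)) := (one_mul _).symm
      _ ≤ max 1 B * (|(NumberField.discr K : ℝ)| * (W.conductorNorm ℤ : ℝ) ^ (6 + ε)) :=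
          mul_le_mul_of_nonneg_right (le_max_left _ _) (le_trans zero_le_one hprod1)
      _ = max 1 B * |(NumberField.discr K : ℝ)| * (W.conductorNorm ℤ : ℝ) ^ (6 + ε) := by ring
  · push_neg at hN
    have hlog := hvK W
    have hΔpos : (0 : ℝ) < (W.minimalDiscriminantNorm ℤ : ℝ) := by
      exact_mod_cast WeierstrassCurve.minimalDiscriminantNorm_pos_holds W
    have hNle : (W.conductorNorm ℤ : ℝ) ≤ (N₀ : ℝ) := by exact_mod_cast hN.le
    have hlogN0 : 0 ≤ Real.log (W.conductorNorm ℤ : ℝ) := Real.log_nonneg hN1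
    have hlogle : Real.log (W.conductorNorm ℤ : ℝ) ≤ Real.log (N₀ : ℝ) :=
      Real.log_le_log (by linarith) hNle
    have hsq : Real.log (W.conductorNorm ℤ : ℝ) ^ 2 ≤ Real.log (N₀ : ℝ) ^ 2 :=
      pow_le_pow_left₀ hlogN0 hlogle 2
    have hmono : 3 * (W.conductorNorm ℤ : ℝ) * Real.log (W.conductorNorm ℤ : ℝ) ^ 2 + 124 ≤
        3 * (N₀ : ℝ) * Real.log (N₀ : ℝ) ^ 2 + 124 := by
      have : (W.conductorNorm ℤ : ℝ) * Real.log (W.conductorNorm ℤ : ℝ) ^ 2 ≤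
          (N₀ : ℝ) * Real.log (N₀ : ℝ) ^ 2 :=
        mul_le_mul hNle hsq (sq_nonneg _) (by positivity)
      linarith
    have hΔle : (W.minimalDiscriminantNorm ℤ : ℝ) ≤ B := by
      calc (W.minimalDiscriminantNorm ℤ : ℝ)
          = Real.exp (Real.log (W.minimalDiscriminantNorm ℤ : ℝ)) := (Real.exp_log hΔpos).symm
        _ ≤ Real.exp (3 * (W.conductorNorm ℤ : ℝ) * Real.log (W.conductorNorm ℤ : ℝ) ^ 2 + 124) :=
            Real.exp_le_exp.mpr hlog
        _ ≤ B := by rw [hB]; exact Real.exp_le_exp.mpr hmono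
    calc (W.minimalDiscriminantNorm ℤ : ℝ) ≤ B := hΔle
      _ ≤ max 1 B := le_max_right _ _
      _ = max 1 B * 1 := (mul_one _).symm
      _ ≤ max 1 B * (|(NumberField.discr K : ℝ)| * (W.conductorNorm ℤ : ℝ) ^ (6 + ε)) :=
          mul_le_mul_of_nonneg_left hprod1 hmax0
      _ = max 1 B * |(NumberField.discr K : ℝ)| * (W.conductorNorm ℤ : ℝ) ^ (6 + ε) := by ring

/-! ## E + F combined — the LOCAL-BUDGET NORMAL FORM (log currency)

`log Δ_min − log|d_K| ≤ (6+ε)·log N + ω(N)·log A` for `N ≥ N₀`: every bad prime carries the budget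
`(6+ε)·f_p·log p + v_p(d_K)·log p + log A`.  With `Real.log_nat_eq_sum_factorization` (LS below) the
left side is k3's SIGNED cross-prime sum `∑_p (n_p − v_p(d_K))·log p`; deficits at shallow primes pay for
deep towers elsewhere (the `j = 2^{-k}` pencil shows the positive-part / prime-wise version is FALSE). -/

/-- **N0 (normal form).** -/
def NormalFormNeg : Prop :=
  ∀ ε : ℝ, 0 < ε → ∃ A : ℝ, 1 ≤ A ∧ ∃ N₀ : ℕ, ∀ (W : WeierstrassCurve ℚ) [W.IsElliptic] (K : Type)
    [Field K] [NumberField K], Irreducible W.twoTorsionPolynomial.toPoly → Module.finrank ℚ K = 3 →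
    (∃ θ : K, aeval θ W.twoTorsionPolynomial.toPoly = 0) → NumberField.discr K < 0 →
    N₀ ≤ W.conductorNorm ℤ →
    Real.log (W.minimalDiscriminantNorm ℤ : ℝ) - Real.log |(NumberField.discr K : ℝ)| ≤
      (6 + ε) * Real.log (W.conductorNorm ℤ : ℝ) +
        ((W.conductorNorm ℤ).primeFactors.card : ℝ) * Real.log A

/-- **N1 (S, VERIFIED).** `stub → normal form` (take logs in F1; `A = 1`). -/
theorem normalForm_of_stub (h : StubComplexCubic) : NormalFormNeg := by
  intro ε hε
  obtain ⟨N₀, hN₀⟩ := eventual_of_stub h ε hε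
  refine ⟨1, le_rfl, N₀, ?_⟩
  intro W _ K _ _ hirr h3 hθ hd hN
  have h1 := hN₀ W K hirr h3 hθ hd hN
  have hΔpos : (0 : ℝ) < (W.minimalDiscriminantNorm ℤ : ℝ) := by
    exact_mod_cast WeierstrassCurve.minimalDiscriminantNorm_pos_holds W
  have hNpos : (0 : ℝ) < (W.conductorNorm ℤ : ℝ) := by
    exact_mod_cast WeierstrassCurve.conductorNorm_pos_holds W
  have hdpos : (0 : ℝ) < |(NumberField.discr K : ℝ)| :=
    abs_pos.mpr (by exact_mod_cast NumberField.discr_ne_zero K)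
  have hlog := Real.log_le_log hΔpos h1
  rw [Real.log_mul hdpos.ne' (Real.rpow_pos_of_pos hNpos _).ne', Real.log_rpow hNpos] at hlog
  simp only [Real.log_one, mul_zero, add_zero]
  linarith

/-- **N2a (M, VERIFIED).** `normal form → eventual form`, UNCONDITIONALLY: in log currency the
bootstrap reads `ω(N)·log A ≤ δ·A^{1/δ} + δ·log N` (tree lemma `pow_card_primeFactors_le`), and the
constant `δ·A^{1/δ}` is absorbed by a third `δ·log N` once `N ≥ exp(A^{1/δ})` (`δ = ε/3`). -/
theorem eventual_of_normalForm (h : NormalFormNeg) : EventualIndexSzpiroNeg := by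
  intro ε hε
  have hδ : 0 < ε / 3 := by linarith
  obtain ⟨A, hA, N₀, hW⟩ := h (ε / 3) hδ
  obtain ⟨c, hc⟩ : ∃ c : ℝ, c = (ε / 3) * A ^ (1 / (ε / 3)) := ⟨_, rfl⟩
  refine ⟨max N₀ ⌈Real.exp (c / (ε / 3))⌉₊, ?_⟩
  intro W _ K _ _ hirr h3 hθ hd hN
  have hN₀ : N₀ ≤ W.conductorNorm ℤ := le_trans (le_max_left _ _) hN
  have hN₁ : ⌈Real.exp (c / (ε / 3))⌉₊ ≤ W.conductorNorm ℤ := le_trans (le_max_right _ _) hN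
  have h1 := hW W K hirr h3 hθ hd hN₀
  have hNpos : 0 < W.conductorNorm ℤ := WeierstrassCurve.conductorNorm_pos_holds W
  have hNne : W.conductorNorm ℤ ≠ 0 := hNpos.ne'
  have hNreal : (0 : ℝ) < (W.conductorNorm ℤ : ℝ) := by exact_mod_cast hNpos
  have hA0 : (0 : ℝ) < A := lt_of_lt_of_le zero_lt_one hA
  have hbudget := pow_card_primeFactors_le hA hδ hNne
  rw [← hc] at hbudget
  have hlogbudget : ((W.conductorNorm ℤ).primeFactors.card : ℝ) * Real.log A ≤
      c + (ε / 3) * Real.log (W.conductorNorm ℤ : ℝ) := by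
    have hl := Real.log_le_log (pow_pos hA0 _) hbudget
    rw [Real.log_pow, Real.log_mul (Real.exp_pos _).ne' (Real.rpow_pos_of_pos hNreal _).ne',
      Real.log_exp, Real.log_rpow hNreal] at hl
    exact hl
  have hcle : c ≤ (ε / 3) * Real.log (W.conductorNorm ℤ : ℝ) := by
    have hexp : Real.exp (c / (ε / 3)) ≤ (W.conductorNorm ℤ : ℝ) :=
      (Nat.le_ceil _).trans (by exact_mod_cast hN₁)
    have hl := Real.log_le_log (Real.exp_pos _) hexp
    rw [Real.log_exp] at hl
    have hl' := (div_le_iff₀ hδ).mp hl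
    linarith
  have hΔpos : (0 : ℝ) < (W.minimalDiscriminantNorm ℤ : ℝ) := by
    exact_mod_cast WeierstrassCurve.minimalDiscriminantNorm_pos_holds W
  have hdpos : (0 : ℝ) < |(NumberField.discr K : ℝ)| :=
    abs_pos.mpr (by exact_mod_cast NumberField.discr_ne_zero K)
  have hrhs : (0 : ℝ) < |(NumberField.discr K : ℝ)| * (W.conductorNorm ℤ : ℝ) ^ (6 + ε) :=
    mul_pos hdpos (Real.rpow_pos_of_pos hNreal _)
  have hring : (6 + ε / 3) * Real.log (W.conductorNorm ℤ : ℝ) +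
      (ε / 3) * Real.log (W.conductorNorm ℤ : ℝ) + (ε / 3) * Real.log (W.conductorNorm ℤ : ℝ) =
      (6 + ε) * Real.log (W.conductorNorm ℤ : ℝ) := by ring
  have hmain : Real.log (W.minimalDiscriminantNorm ℤ : ℝ) ≤
      Real.log (|(NumberField.discr K : ℝ)| * (W.conductorNorm ℤ : ℝ) ^ (6 + ε)) := by
    rw [Real.log_mul hdpos.ne' (Real.rpow_pos_of_pos hNreal _).ne', Real.log_rpow hNreal]
    linarith
  exact (Real.log_le_log_iff hΔpos hrhs).mp hmain

/-- **N2 (M, VERIFIED modulo the named fact).** `normal form → stub`: N2a, then F2's vK constant for the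
conductors `N < N₀`. -/
theorem stub_of_normalForm (hvK : vonKanel2014_log_minimalDiscriminant_le) (h : NormalFormNeg) :
    StubComplexCubic :=
  stub_of_eventual hvK (eventual_of_normalForm h)

/-- **LS (S, VERIFIED).** Localisation identity: `log Δ_min = ∑_{p ∣ N_E} v_p(Δ_min)·log p` (sum over
the primes of the CONDUCTOR, by `WeierstrassCurve.primeFactors_minimalDiscriminantNorm`). -/
theorem LS_log_minimalDiscriminantNorm (W : WeierstrassCurve ℚ) [W.IsElliptic] :
    Real.log (W.minimalDiscriminantNorm ℤ : ℝ) =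
      ∑ p ∈ (W.conductorNorm ℤ).primeFactors,
        ((W.minimalDiscriminantNorm ℤ).factorization p : ℝ) * Real.log p := by
  rw [Real.log_nat_eq_sum_factorization, Finsupp.sum, Nat.support_factorization,
    WeierstrassCurve.primeFactors_minimalDiscriminantNorm]

/-- **LS′ (S, VERIFIED).** Same for the conductor: `log N_E = ∑_{p ∣ N_E} f_p·log p`. -/
theorem LS_log_conductorNorm (W : WeierstrassCurve ℚ) :
    Real.log (W.conductorNorm ℤ : ℝ) =
      ∑ p ∈ (W.conductorNorm ℤ).primeFactors,
        ((W.conductorNorm ℤ).factorization p : ℝ) * Real.log p := by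
  rw [Real.log_nat_eq_sum_factorization, Finsupp.sum, Nat.support_factorization]

/-! ## Technique G — QUANTIFIER ELIMINATION of `K`: the resolvent field is rigid

Since `ψ_W` is irreducible of degree 3, any cubic number field containing a root is `ℚ(θ) ≃ ℚ[x]/(ψ_W)`;
so `d_K` is a function of `W` alone and "`∀ K`" in the stub is one isomorphism class per curve. -/

open IntermediateField in
/-- **G1 (M, VERIFIED).** Two resolvent fields of the same curve are isomorphic: `minpoly ℚ θᵢ =
ψ_W · C (lc ψ_W)⁻¹` (`minpoly.eq_of_irreducible`), `natDegree = 3 = finrank ⇒ ℚ⟮θᵢ⟯ = ⊤`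
(`Field.primitive_element_iff_minpoly_natDegree_eq`), and `Kᵢ ≃ ℚ[x]/(minpoly)`
(`IntermediateField.adjoinRootEquivAdjoin`, `AdjoinRoot.algEquivOfEq`). -/
theorem G1_resolvent_algEquiv (W : WeierstrassCurve ℚ) (K₁ K₂ : Type) [Field K₁] [NumberField K₁]
    [Field K₂] [NumberField K₂] (hirr : Irreducible W.twoTorsionPolynomial.toPoly)
    (h₁ : Module.finrank ℚ K₁ = 3) (h₂ : Module.finrank ℚ K₂ = 3)
    (hθ₁ : ∃ θ : K₁, aeval θ W.twoTorsionPolynomial.toPoly = 0)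
    (hθ₂ : ∃ θ : K₂, aeval θ W.twoTorsionPolynomial.toPoly = 0) : Nonempty (K₁ ≃ₐ[ℚ] K₂) := by
  obtain ⟨θ₁, hθ₁⟩ := hθ₁
  obtain ⟨θ₂, hθ₂⟩ := hθ₂
  have hi₁ : IsIntegral ℚ θ₁ := IsIntegral.of_finite ℚ θ₁
  have hi₂ : IsIntegral ℚ θ₂ := IsIntegral.of_finite ℚ θ₂
  have hmin : minpoly ℚ θ₁ = minpoly ℚ θ₂ := by
    rw [← minpoly.eq_of_irreducible hirr hθ₁, ← minpoly.eq_of_irreducible hirr hθ₂]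
  have hdegψ : W.twoTorsionPolynomial.toPoly.natDegree = 3 :=
    Cubic.natDegree_of_a_ne_zero (by norm_num [WeierstrassCurve.twoTorsionPolynomial])
  have hlc : (W.twoTorsionPolynomial.toPoly.leadingCoeff)⁻¹ ≠ 0 :=
    inv_ne_zero (Polynomial.leadingCoeff_ne_zero.mpr hirr.ne_zero)
  have hd₁ : (minpoly ℚ θ₁).natDegree = 3 := by
    rw [← minpoly.eq_of_irreducible hirr hθ₁, Polynomial.natDegree_mul_C hlc, hdegψ]
  have hd₂ : (minpoly ℚ θ₂).natDegree = 3 := by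
    rw [← minpoly.eq_of_irreducible hirr hθ₂, Polynomial.natDegree_mul_C hlc, hdegψ]
  have htop₁ : ℚ⟮θ₁⟯ = ⊤ :=
    (Field.primitive_element_iff_minpoly_natDegree_eq ℚ θ₁).mpr (by rw [hd₁, h₁])
  have htop₂ : ℚ⟮θ₂⟯ = ⊤ :=
    (Field.primitive_element_iff_minpoly_natDegree_eq ℚ θ₂).mpr (by rw [hd₂, h₂])
  let e₁ : AdjoinRoot (minpoly ℚ θ₁) ≃ₐ[ℚ] K₁ :=
    (adjoinRootEquivAdjoin ℚ hi₁).trans ((equivOfEq htop₁).trans topEquiv)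
  let e₂ : AdjoinRoot (minpoly ℚ θ₂) ≃ₐ[ℚ] K₂ :=
    (adjoinRootEquivAdjoin ℚ hi₂).trans ((equivOfEq htop₂).trans topEquiv)
  exact ⟨(e₁.symm.trans (AdjoinRoot.algEquivOfEq ℚ _ _ hmin)).trans e₂⟩

/-- **G2 (S from G1, VERIFIED).** Hence the allowance `d_K` does not depend on the choice of
`K` (Mathlib `NumberField.discr_eq_discr_of_algEquiv`). -/
theorem G2_resolvent_discr_eq (W : WeierstrassCurve ℚ) (K₁ K₂ : Type) [Field K₁] [NumberField K₁]
    [Field K₂] [NumberField K₂] (hirr : Irreducible W.twoTorsionPolynomial.toPoly)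
    (h₁ : Module.finrank ℚ K₁ = 3) (h₂ : Module.finrank ℚ K₂ = 3)
    (hθ₁ : ∃ θ : K₁, aeval θ W.twoTorsionPolynomial.toPoly = 0)
    (hθ₂ : ∃ θ : K₂, aeval θ W.twoTorsionPolynomial.toPoly = 0) :
    NumberField.discr K₁ = NumberField.discr K₂ := by
  obtain ⟨e⟩ := G1_resolvent_algEquiv W K₁ K₂ hirr h₁ h₂ hθ₁ hθ₂
  exact NumberField.discr_eq_discr_of_algEquiv K₁ e

/-- Sanity: `StubComplexCubic` is the registered signature up to the `Polynomial.` prefix. -/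
example : StubComplexCubic ↔
    (∀ ε : ℝ, 0 < ε → ∃ C : ℝ, ∀ (W : WeierstrassCurve ℚ) [W.IsElliptic] (K : Type) [Field K]
      [NumberField K], Irreducible W.twoTorsionPolynomial.toPoly → Module.finrank ℚ K = 3 →
      (∃ θ : K, Polynomial.aeval θ W.twoTorsionPolynomial.toPoly = 0) → NumberField.discr K < 0 →
      (W.minimalDiscriminantNorm ℤ : ℝ) ≤
        C * |(NumberField.discr K : ℝ)| * (W.conductorNorm ℤ : ℝ) ^ (6 + ε)) := Iff.rfl

end Summit.ABC.ABC.Cruxes.IndexSzpiro.StubIdeas2G3
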